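import Literature.MathematicalPhysics.QuantumManyBody.BogoliubovSpectrumGP
import Literature.MathematicalPhysics.QuantumManyBody.WeightedCorrector
import Mathlib.Analysis.SpecialFunctions.Complex.Arg
import Mathlib.Analysis.InnerProductSpace.Basic
import Mathlib.Analysis.Calculus.FDeriv.Add
import Mathlib.Analysis.Calculus.FDeriv.Measurable
import Mathlib.MeasureTheory.Constructions.Polish.Basic
import HarnessLib

/-!
# Clustering of near-minimisers from a spectral gap in Ky Fan form (periodic `N`-body Hamiltonian)

Topic `Literature/MathematicalPhysics/QuantumManyBody`, companion of `BogoliubovSpectrumGP.lean`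
(`kyFanTwo v N L = inf {⟨Ψ₁,HΨ₁⟩ + ⟨Ψ₂,HΨ₂⟩ : Ψ₁ ⊥ Ψ₂}` over the periodic `C¹` Bose core) and of
`Literature/Analysis/UnboundedOperators/KyFanFormGap.lean` (form gap in Ky Fan form). The tree states
the spectral data of `H = ∑ⱼ -Δⱼ + ∑_{i<j} v^per(xᵢ - xⱼ)` on `((ℝ/Lℤ)³)^N` VARIATIONALLY over
`PeriodicTrialState N L`; a hard-core ground state is Lipschitz, not `C¹`, so "uniqueness of the
ground state" has to be phrased WITHOUT a ground-state vector. Two such phrasings are in use: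

* the **Ky Fan gap** `2 E₀ + γ ≤ kyFanTwo v N L` (`E₀ = periodicGroundStateEnergy v N L`): the two
  lowest levels of the form, counted with multiplicity, differ by at least `γ` — for a form with
  compact resolvent this is exactly SIMPLICITY of the ground state with gap `γ`
  [ReedSimonIV1978, Thm. XIII.1–2];
* **clustering of near-minimisers** (Cauchy form of "near-minimisers converge to the ground state"):
  for every `η > 0` there is `δ > 0` such that any two trial states of energy `≤ E₀ + δ` are
  `L²(cell)`-close up to a phase, `∫_{[0,L)^{3N}} |Φ - e^{iθ}Φ'|² ≤ η`.

**Main result** `exists_phase_integral_norm_sub_sq_le_of_kyFanGap`: the Ky Fan gap implies clustering,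
for EVERY pair-potential profile `v : ℝ → [0,∞]` that is measurable (hard cores `v = ⊤` and all other
non-integrable profiles included), every `N` and every `L`, with the explicit modulus `δ = γη/16`.
No compactness, no spectral theorem and no ground state are used: the proof is the parallelogram law.
Given near-minimisers `Φ, Φ'`, rotate `Φ'` by the phase `c = e^{i arg⟨Φ',Φ⟩}` so that
`⟨cΦ', Φ⟩ ≥ 0`; then `u = Φ + cΦ'` and `w = Φ - cΦ'` are `L²`-ORTHOGONAL core functions with
`‖u‖² + ‖w‖² = 4` and, by the parallelogram law for the (nonnegative, possibly infinite) energy form,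
`q(u) + q(w) = 2q(Φ) + 2q(Φ') ≤ 4E₀ + 4δ`. Normalising `u, w` gives an orthogonal pair of trial
states, so the Ky Fan gap and `q(u) ≥ E₀‖u‖²`, `q(w) ≥ E₀‖w‖²` force `γ ‖u‖² ‖w‖² ≤ 16 δ`, whence
`min(‖u‖², ‖w‖²) ≤ 8δ/γ`; the smaller one is `∫ |Φ - e^{iθ}Φ'|²` for `θ = arg⟨Φ',Φ⟩` or
`θ = arg⟨Φ',Φ⟩ + π` (`min_le_of_kyFan_bookkeeping` is the real-arithmetic step).

Also recorded (all proved, no named facts, no definitions): the parallelogram law and the scaling law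
for the energy integrand and the energy (`kineticDensity_fun_add_add_sub`,
`lintegral_periodicEnergy_add_add_sub`, `lintegral_periodicEnergy_const_mul`), the normalising
constructor `exists_periodicTrialState_const_mul`, and `integral_cellN_conj_mul_self_trialState`
(`⟨Ψ,Ψ⟩_cell = 1` as a Bochner integral).

Used by the crux line `third-law-current-floor` of `BECConjugateDomination.HardCoreExtension`
(stmt-AtomisticToContinuum-11786), stub S5 `stub_diluteClustering`, whose clustering clause at fixed
`(N, L)` is hereby reduced to the Ky Fan gap `2E₀ < kyFanTwo`.

## References

* [ReedSimonIV1978] M. Reed, B. Simon, *Methods of Modern Mathematical Physics IV* (1978), Thm. XIII.1–2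
  (min–max for the two lowest levels), §XIII.12 (non-degenerate ground states).
* Ky Fan, Proc. Nat. Acad. Sci. USA 35 (1949) 652–655, Thm. 1 (folklore form).
-/

noncomputable section

open MeasureTheory Filter
open scoped ENNReal NNReal ComplexConjugate

namespace Literature.MathematicalPhysics.QuantumManyBody.BoseGas

variable {N : ℕ} {L : ℝ} {v : ℝ → ℝ≥0∞}

/-! ### Pointwise algebra: parallelogram and scaling laws for the energy integrand -/

/-- The parallelogram law in `ℂ`, read in `ℝ≥0∞`: `|a+b|² + |a-b|² = 2(|a|² + |b|²)`. [folklore] -/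
theorem ennreal_sq_nnnorm_add_add_sub (a b : ℂ) :
    ((‖a + b‖₊ : ℝ≥0∞)) ^ 2 + ((‖a - b‖₊ : ℝ≥0∞)) ^ 2 =
      2 * (((‖a‖₊ : ℝ≥0∞)) ^ 2 + ((‖b‖₊ : ℝ≥0∞)) ^ 2) := by
  have h := congrArg (fun r : ℝ≥0 => (r : ℝ≥0∞)) (parallelogram_law_with_nnnorm ℂ a b)
  push_cast at h
  exact h

/-- `(‖z‖₊ : ℝ≥0∞)² = ENNReal.ofReal ‖z‖²` (copy of `ennnorm_sq_eq_ofReal` of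
`DiluteBoseGasUpperBoundLocalization.lean`, kept private to avoid that import). [folklore] -/
private theorem ennreal_coe_nnnorm_sq (z : ℂ) : ((‖z‖₊ : ℝ≥0∞)) ^ 2 = ENNReal.ofReal (‖z‖ ^ 2) := by
  rw [← ENNReal.coe_pow, ENNReal.ofReal, Real.toNNReal_pow (norm_nonneg _), norm_toNNReal]

/-- **Parallelogram law for the kinetic density**: `|∇(φ+ψ)|² + |∇(φ-ψ)|² = 2(|∇φ|² + |∇ψ|²)`
pointwise, for differentiable `φ, ψ`. [folklore] -/
theorem kineticDensity_fun_add_add_sub {φ ψ : Config N → ℂ} (hφ : Differentiable ℝ φ)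
    (hψ : Differentiable ℝ ψ) (X : Config N) :
    kineticDensity (fun Y => φ Y + ψ Y) X + kineticDensity (fun Y => φ Y - ψ Y) X =
      2 * (kineticDensity φ X + kineticDensity ψ X) := by
  unfold kineticDensity
  rw [fderiv_fun_add (hφ X) (hψ X), fderiv_fun_sub (hφ X) (hψ X)]
  simp only [FunLike.coe_add, FunLike.coe_sub, Pi.add_apply, Pi.sub_apply,
    mul_add, Finset.mul_sum, ← Finset.sum_add_distrib]
  refine Finset.sum_congr rfl fun i _ => Finset.sum_congr rfl fun k _ => ?_
  rw [ennreal_sq_nnnorm_add_add_sub, mul_add]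

/-- **Scaling law for the kinetic density**: `|∇(cψ)|² = |c|²|∇ψ|²` pointwise. [folklore] -/
theorem kineticDensity_fun_const_mul (c : ℂ) {ψ : Config N → ℂ} (hψ : Differentiable ℝ ψ)
    (X : Config N) :
    kineticDensity (fun Y => c * ψ Y) X = ((‖c‖₊ : ℝ≥0∞)) ^ 2 * kineticDensity ψ X := by
  unfold kineticDensity
  have h : fderiv ℝ (fun Y => c * ψ Y) X = c • fderiv ℝ ψ X := fderiv_fun_const_smul (hψ X) c
  rw [h]
  simp only [FunLike.coe_smul, Pi.smul_apply, smul_eq_mul, Finset.mul_sum]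
  refine Finset.sum_congr rfl fun i _ => Finset.sum_congr rfl fun k _ => ?_
  rw [nnnorm_mul, ENNReal.coe_mul, mul_pow]

/-! ### Measurability -/

/-- The kinetic density of any function is measurable. [folklore] -/
theorem measurable_kineticDensity_of_any (ψ : Config N → ℂ) : Measurable (kineticDensity ψ) := by
  refine Finset.measurable_sum _ fun i _ => Finset.measurable_sum _ fun k _ => ?_
  exact ((measurable_fderiv_apply_const ℝ ψ _).nnnorm.coe_nnreal_ennreal).pow_const 2

/-- The `i`-th particle coordinate is a measurable function of the configuration. [folklore] -/
private theorem measurable_config_apply' (i : Fin N) : Measurable fun X : Config N => X i :=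
  measurable_pi_apply i

/-- The periodic interaction of a measurable profile is measurable (copy of
`measurable_periodicInteraction` of `DiluteBoseGasUpperBoundLocalization.lean`, kept private to avoid
that import). [folklore] -/
private theorem measurable_periodicInteraction_of_measurable (hv : Measurable v) (L : ℝ) :
    Measurable (periodicInteraction (N := N) v L) := by
  unfold periodicInteraction periodizedPotential
  refine Finset.measurable_sum _ fun i _ => Finset.measurable_sum _ fun j _ => ?_
  exact (Measurable.tsum fun n => hv.comp (measurable_id.sub_const _).norm).comp
    ((measurable_config_apply' i).sub (measurable_config_apply' j))

/-- The energy integrand `|∇χ|² + W|χ|²` of a continuous `χ` is measurable. [folklore] -/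
theorem measurable_energyIntegrand (hv : Measurable v) (L : ℝ) {χ : Config N → ℂ}
    (hχ : Continuous χ) :
    Measurable fun X => kineticDensity χ X +
      periodicInteraction v L X * ((‖χ X‖₊ : ℝ≥0∞)) ^ 2 :=
  (measurable_kineticDensity_of_any χ).add ((measurable_periodicInteraction_of_measurable hv L).mul
    ((hχ.measurable.nnnorm.coe_nnreal_ennreal).pow_const 2))

/-- `X ↦ |χ X|²` is measurable for continuous `χ`. [folklore] -/
theorem measurable_coe_nnnorm_sq {χ : Config N → ℂ} (hχ : Continuous χ) :
    Measurable fun X => ((‖χ X‖₊ : ℝ≥0∞)) ^ 2 :=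
  (hχ.measurable.nnnorm.coe_nnreal_ennreal).pow_const 2

/-! ### The energy and the cell norm of sums, differences and multiples -/

/-- **Parallelogram law for the periodic energy** (all `v`, hard cores included):
`q(φ+ψ) + q(φ-ψ) = 2q(φ) + 2q(ψ)` for the (possibly infinite) energy
`q(χ) = ∫_{[0,L)^{3N}} |∇χ|² + W|χ|²`, `W = ∑_{i<j} v^per(xᵢ-xⱼ)`, of `C¹` functions. [folklore] -/
theorem lintegral_periodicEnergy_add_add_sub (hv : Measurable v) (L : ℝ) {φ ψ : Config N → ℂ}
    (hφ : ContDiff ℝ 1 φ) (hψ : ContDiff ℝ 1 ψ) :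
    (∫⁻ X in cellN N L, kineticDensity (fun Y => φ Y + ψ Y) X +
        periodicInteraction v L X * ((‖φ X + ψ X‖₊ : ℝ≥0∞)) ^ 2) +
    (∫⁻ X in cellN N L, kineticDensity (fun Y => φ Y - ψ Y) X +
        periodicInteraction v L X * ((‖φ X - ψ X‖₊ : ℝ≥0∞)) ^ 2) =
    2 * (∫⁻ X in cellN N L, kineticDensity φ X +
        periodicInteraction v L X * ((‖φ X‖₊ : ℝ≥0∞)) ^ 2) +
    2 * (∫⁻ X in cellN N L, kineticDensity ψ X +
        periodicInteraction v L X * ((‖ψ X‖₊ : ℝ≥0∞)) ^ 2) := by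
  have hA := measurable_energyIntegrand hv L (χ := fun Y => φ Y + ψ Y) (hφ.continuous.add hψ.continuous)
  have hC := measurable_energyIntegrand hv L hφ.continuous
  have hD := measurable_energyIntegrand hv L hψ.continuous
  have H : ∫⁻ X in cellN N L, ((kineticDensity (fun Y => φ Y + ψ Y) X +
        periodicInteraction v L X * ((‖φ X + ψ X‖₊ : ℝ≥0∞)) ^ 2) +
      (kineticDensity (fun Y => φ Y - ψ Y) X +
        periodicInteraction v L X * ((‖φ X - ψ X‖₊ : ℝ≥0∞)) ^ 2)) =
      ∫⁻ X in cellN N L, (2 * (kineticDensity φ X +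
        periodicInteraction v L X * ((‖φ X‖₊ : ℝ≥0∞)) ^ 2) +
      2 * (kineticDensity ψ X + periodicInteraction v L X * ((‖ψ X‖₊ : ℝ≥0∞)) ^ 2)) := by
    refine lintegral_congr fun X => ?_
    have hk := kineticDensity_fun_add_add_sub (hφ.differentiable one_ne_zero)
      (hψ.differentiable one_ne_zero) X
    have hn := ennreal_sq_nnnorm_add_add_sub (φ X) (ψ X)
    calc _ = (kineticDensity (fun Y => φ Y + ψ Y) X + kineticDensity (fun Y => φ Y - ψ Y) X) +
          periodicInteraction v L X *
            (((‖φ X + ψ X‖₊ : ℝ≥0∞)) ^ 2 + ((‖φ X - ψ X‖₊ : ℝ≥0∞)) ^ 2) := by ring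
      _ = 2 * (kineticDensity φ X + kineticDensity ψ X) + periodicInteraction v L X *
            (2 * (((‖φ X‖₊ : ℝ≥0∞)) ^ 2 + ((‖ψ X‖₊ : ℝ≥0∞)) ^ 2)) := by rw [hk, hn]
      _ = _ := by ring
  rw [lintegral_add_left hA, lintegral_add_left (hC.const_mul 2), lintegral_const_mul _ hC,
    lintegral_const_mul _ hD] at H
  exact H

/-- **Scaling law for the periodic energy**: `q(cψ) = |c|² q(ψ)`. [folklore] -/
theorem lintegral_periodicEnergy_const_mul (v : ℝ → ℝ≥0∞) (L : ℝ) (c : ℂ) {ψ : Config N → ℂ}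
    (hψ : ContDiff ℝ 1 ψ) :
    ∫⁻ X in cellN N L, kineticDensity (fun Y => c * ψ Y) X +
        periodicInteraction v L X * ((‖c * ψ X‖₊ : ℝ≥0∞)) ^ 2 =
      ((‖c‖₊ : ℝ≥0∞)) ^ 2 * ∫⁻ X in cellN N L, kineticDensity ψ X +
        periodicInteraction v L X * ((‖ψ X‖₊ : ℝ≥0∞)) ^ 2 := by
  rw [← lintegral_const_mul' _ _ (ENNReal.pow_ne_top ENNReal.coe_ne_top)]
  refine lintegral_congr fun X => ?_
  rw [kineticDensity_fun_const_mul c (hψ.differentiable one_ne_zero) X, nnnorm_mul, ENNReal.coe_mul,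
    mul_pow]
  ring

/-- Scaling of the cell norm: `‖cψ‖² = |c|²‖ψ‖²`. [folklore] -/
theorem lintegral_cellN_sq_const_mul (L : ℝ) (c : ℂ) (ψ : Config N → ℂ) :
    ∫⁻ X in cellN N L, ((‖c * ψ X‖₊ : ℝ≥0∞)) ^ 2 =
      ((‖c‖₊ : ℝ≥0∞)) ^ 2 * ∫⁻ X in cellN N L, ((‖ψ X‖₊ : ℝ≥0∞)) ^ 2 := by
  rw [← lintegral_const_mul' _ _ (ENNReal.pow_ne_top ENNReal.coe_ne_top)]
  refine lintegral_congr fun X => ?_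
  rw [nnnorm_mul, ENNReal.coe_mul, mul_pow]

/-- Parallelogram law for the cell norm: `‖φ+ψ‖² + ‖φ-ψ‖² = 2‖φ‖² + 2‖ψ‖²`. [folklore] -/
theorem lintegral_cellN_sq_add_add_sub (L : ℝ) {φ ψ : Config N → ℂ} (hφ : Continuous φ)
    (hψ : Continuous ψ) :
    (∫⁻ X in cellN N L, ((‖φ X + ψ X‖₊ : ℝ≥0∞)) ^ 2) +
      (∫⁻ X in cellN N L, ((‖φ X - ψ X‖₊ : ℝ≥0∞)) ^ 2) =
    2 * (∫⁻ X in cellN N L, ((‖φ X‖₊ : ℝ≥0∞)) ^ 2) +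
      2 * (∫⁻ X in cellN N L, ((‖ψ X‖₊ : ℝ≥0∞)) ^ 2) := by
  have H : ∫⁻ X in cellN N L, (((‖φ X + ψ X‖₊ : ℝ≥0∞)) ^ 2 + ((‖φ X - ψ X‖₊ : ℝ≥0∞)) ^ 2) =
      ∫⁻ X in cellN N L, (2 * ((‖φ X‖₊ : ℝ≥0∞)) ^ 2 + 2 * ((‖ψ X‖₊ : ℝ≥0∞)) ^ 2) :=
    lintegral_congr fun X => by rw [ennreal_sq_nnnorm_add_add_sub, mul_add]
  rw [lintegral_add_left (measurable_coe_nnnorm_sq (χ := fun Y => φ Y + ψ Y) (hφ.add hψ)),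
    lintegral_add_left ((measurable_coe_nnnorm_sq hφ).const_mul 2),
    lintegral_const_mul _ (measurable_coe_nnnorm_sq hφ),
    lintegral_const_mul _ (measurable_coe_nnnorm_sq hψ)] at H
  exact H

/-! ### Bochner bookkeeping on the cell -/

/-- `∫_cell ‖F‖² = (∫⁻_cell ‖F‖₊²).toReal` for continuous `F`. [folklore] -/
theorem integral_cellN_norm_sq_eq_toReal (L : ℝ) {F : Config N → ℂ} (hF : Continuous F) :
    ∫ X in cellN N L, ‖F X‖ ^ 2 = (∫⁻ X in cellN N L, ((‖F X‖₊ : ℝ≥0∞)) ^ 2).toReal := by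
  rw [integral_eq_lintegral_of_nonneg_ae (f := fun X => ‖F X‖ ^ 2)
    (Eventually.of_forall fun X => by positivity) ((hF.norm.pow 2).aestronglyMeasurable)]
  simp only [← ennreal_coe_nnnorm_sq]

/-- `∫_cell conj(F) F = (∫⁻_cell ‖F‖₊²).toReal` (as a complex number) for continuous `F`. [folklore] -/
theorem integral_cellN_conj_mul_self (L : ℝ) {F : Config N → ℂ} (hF : Continuous F) :
    ∫ X in cellN N L, conj (F X) * F X =
      (((∫⁻ X in cellN N L, ((‖F X‖₊ : ℝ≥0∞)) ^ 2).toReal : ℝ) : ℂ) := by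
  have h : (fun X => conj (F X) * F X) = fun X => (((‖F X‖ ^ 2 : ℝ)) : ℂ) := by
    funext X; rw [Complex.conj_mul', Complex.ofReal_pow]
  rw [h, show (∫ X in cellN N L, (((‖F X‖ ^ 2 : ℝ)) : ℂ)) = (((∫ X in cellN N L, ‖F X‖ ^ 2 : ℝ)) : ℂ)
    from integral_ofReal, integral_cellN_norm_sq_eq_toReal L hF]

/-- For a periodic trial state `⟨Ψ, Ψ⟩_cell = 1` (Bochner form of `Ψ.norm_eq`). [folklore] -/
theorem integral_cellN_conj_mul_self_trialState (Ψ : PeriodicTrialState N L) :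
    ∫ X in cellN N L, conj (Ψ.ψ X) * Ψ.ψ X = 1 := by
  rw [integral_cellN_conj_mul_self L Ψ.contDiff.continuous, Ψ.norm_eq, ENNReal.toReal_one,
    Complex.ofReal_one]

/-! ### Normalising a core function -/

/-- **Normalising constructor (existential form).** A `C¹`, `Lℤ³`-periodic, Bose-symmetric `u`
with `0 < ‖u‖²_cell < ∞` is a positive real multiple `a⁻¹` of a periodic trial state:
`Ψ = a u` with `|a|² = (‖u‖²_cell)⁻¹`. [folklore] -/
theorem exists_periodicTrialState_const_mul {u : Config N → ℂ} (hu : ContDiff ℝ 1 u)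
    (hper : ∀ (X : Config N) (i : Fin N) (k : Fin 3),
      u (X + Pi.single i (EuclideanSpace.single k L)) = u X)
    (hsymm : ∀ (σ : Equiv.Perm (Fin N)) (X : Config N), u (X ∘ σ) = u X)
    (h0 : ∫⁻ X in cellN N L, ((‖u X‖₊ : ℝ≥0∞)) ^ 2 ≠ 0)
    (htop : ∫⁻ X in cellN N L, ((‖u X‖₊ : ℝ≥0∞)) ^ 2 ≠ ⊤) :
    ∃ (Ψ : PeriodicTrialState N L) (a : ℝ), (Ψ.ψ = fun X => (a : ℂ) * u X) ∧
      ((‖(a : ℂ)‖₊ : ℝ≥0∞)) ^ 2 = (∫⁻ X in cellN N L, ((‖u X‖₊ : ℝ≥0∞)) ^ 2)⁻¹ := by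
  set I := ∫⁻ X in cellN N L, ((‖u X‖₊ : ℝ≥0∞)) ^ 2 with hI
  have hIpos : 0 < I.toReal := ENNReal.toReal_pos h0 htop
  set a : ℝ := (Real.sqrt I.toReal)⁻¹ with ha_def
  have ha : ((‖(a : ℂ)‖₊ : ℝ≥0∞)) ^ 2 = I⁻¹ := by
    rw [ennreal_coe_nnnorm_sq, Complex.norm_real, Real.norm_of_nonneg (by positivity), ha_def, inv_pow,
      Real.sq_sqrt hIpos.le, ENNReal.ofReal_inv_of_pos hIpos, ENNReal.ofReal_toReal htop]
  refine ⟨⟨fun X => (a : ℂ) * u X, contDiff_const.mul hu,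
    fun X i k => by simp only [hper], fun σ X => by simp only [hsymm], ?_⟩, a, rfl, ha⟩
  rw [lintegral_cellN_sq_const_mul, ha, ENNReal.inv_mul_cancel h0 htop]

/-! ### The real-arithmetic step -/

/-- **Bookkeeping.** With `p = ‖u‖², m = ‖w‖²` (`p + m = 4`), `a = q(u)`, `b = q(w)`
(`a + b ≤ 4E₀ + 4δ`), the variational bounds `E₀ p ≤ a`, `E₀ m ≤ b` and the Ky Fan gap
`2E₀ + γ ≤ a/p + b/m` give `min(p, m) ≤ 8δ/γ`. [folklore] -/
theorem min_le_of_kyFan_bookkeeping {e γ δ a b p m : ℝ} (hγ : 0 < γ) (hδ : 0 ≤ δ) (hp : 0 ≤ p)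
    (hm : 0 ≤ m) (hpm : p + m = 4) (hab : a + b ≤ 4 * e + 4 * δ) (ha : p ≠ 0 → e * p ≤ a)
    (hb : m ≠ 0 → e * m ≤ b) (hg : p ≠ 0 → m ≠ 0 → 2 * e + γ ≤ p⁻¹ * a + m⁻¹ * b) :
    min p m ≤ 8 * δ / γ := by
  by_cases hp0 : p = 0
  · rw [hp0, min_eq_left hm]; positivity
  by_cases hm0 : m = 0
  · rw [hm0, min_eq_right hp]; positivity
  have hp' : 0 < p := lt_of_le_of_ne hp (Ne.symm hp0)
  have hm' : 0 < m := lt_of_le_of_ne hm (Ne.symm hm0)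
  have h1 := ha hp0
  have h2 := hb hm0
  have h3 := hg hp0 hm0
  have hsum : e * p + e * m = 4 * e := by rw [← mul_add, hpm]; ring
  have hap : a ≤ e * p + 4 * δ := by linarith
  have hbm : b ≤ e * m + 4 * δ := by linarith
  have h4 : p⁻¹ * a ≤ e + 4 * δ / p := by
    rw [inv_mul_le_iff₀ hp']
    calc a ≤ e * p + 4 * δ := hap
      _ = p * (e + 4 * δ / p) := by field_simp
  have h5 : m⁻¹ * b ≤ e + 4 * δ / m := by
    rw [inv_mul_le_iff₀ hm']
    calc b ≤ e * m + 4 * δ := hbm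
      _ = m * (e + 4 * δ / m) := by field_simp
  have h6 : γ ≤ 4 * δ / p + 4 * δ / m := by linarith
  have key : γ * (p * m) ≤ 16 * δ := by
    calc γ * (p * m) ≤ (4 * δ / p + 4 * δ / m) * (p * m) := by gcongr
      _ = 4 * δ * (p + m) := by field_simp; ring
      _ = 16 * δ := by rw [hpm]; ring
  rcases le_total p m with h | h
  · rw [min_eq_left h, le_div_iff₀ hγ]
    have hm2 : 2 ≤ m := by linarith
    nlinarith [mul_nonneg (mul_nonneg hγ.le hp) (sub_nonneg.2 hm2)]
  · rw [min_eq_right h, le_div_iff₀ hγ]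
    have hp2 : 2 ≤ p := by linarith
    nlinarith [mul_nonneg (mul_nonneg hγ.le hm) (sub_nonneg.2 hp2)]

/-- **Bookkeeping in `ℝ≥0∞`.** The same conclusion from the `ℝ≥0∞`-valued data of the variational
problem (`E₀ < ∞`, `p + m = 4`, `q(u) + q(w) ≤ 4E₀ + 4δ`, `E₀ p ≤ q(u)`, `E₀ m ≤ q(w)`, Ky Fan gap).
[folklore] -/
theorem min_toReal_le_of_kyFan_bookkeeping {E₀ Au Aw p m : ℝ≥0∞} {γ δ : ℝ} (hγ : 0 < γ)
    (hδ : 0 ≤ δ) (hE : E₀ ≠ ⊤) (hpm : p + m = 4)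
    (hab : Au + Aw ≤ 4 * E₀ + 4 * ENNReal.ofReal δ)
    (ha : p ≠ 0 → E₀ * p ≤ Au) (hb : m ≠ 0 → E₀ * m ≤ Aw)
    (hg : p ≠ 0 → m ≠ 0 → 2 * E₀ + ENNReal.ofReal γ ≤ p⁻¹ * Au + m⁻¹ * Aw) :
    min p.toReal m.toReal ≤ 8 * δ / γ := by
  have h4 : (4 : ℝ≥0∞) ≠ ⊤ := by norm_num
  have hp_top : p ≠ ⊤ := ne_top_of_le_ne_top h4 (hpm ▸ le_self_add)
  have hm_top : m ≠ ⊤ := ne_top_of_le_ne_top h4 (hpm ▸ le_add_self)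
  have hR : 4 * E₀ + 4 * ENNReal.ofReal δ ≠ ⊤ := ENNReal.add_ne_top.2
    ⟨ENNReal.mul_ne_top h4 hE, ENNReal.mul_ne_top h4 ENNReal.ofReal_ne_top⟩
  have hAu : Au ≠ ⊤ := ne_top_of_le_ne_top hR (le_self_add.trans hab)
  have hAw : Aw ≠ ⊤ := ne_top_of_le_ne_top hR (le_add_self.trans hab)
  refine min_le_of_kyFan_bookkeeping (e := E₀.toReal) (a := Au.toReal) (b := Aw.toReal) hγ hδ
    ENNReal.toReal_nonneg ENNReal.toReal_nonneg ?_ ?_ ?_ ?_ ?_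
  · rw [← ENNReal.toReal_add hp_top hm_top, hpm]; norm_num
  · have h := ENNReal.toReal_mono hR hab
    rwa [ENNReal.toReal_add hAu hAw, ENNReal.toReal_add (ENNReal.mul_ne_top h4 hE)
      (ENNReal.mul_ne_top h4 ENNReal.ofReal_ne_top), ENNReal.toReal_mul, ENNReal.toReal_mul,
      ENNReal.toReal_ofReal hδ, ENNReal.toReal_ofNat] at h
  · intro hp0
    have hp0' : p ≠ 0 := fun h => hp0 (by rw [h, ENNReal.toReal_zero])
    have h := ENNReal.toReal_mono hAu (ha hp0')
    rwa [ENNReal.toReal_mul] at h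
  · intro hm0
    have hm0' : m ≠ 0 := fun h => hm0 (by rw [h, ENNReal.toReal_zero])
    have h := ENNReal.toReal_mono hAw (hb hm0')
    rwa [ENNReal.toReal_mul] at h
  · intro hp0 hm0
    have hp0' : p ≠ 0 := fun h => hp0 (by rw [h, ENNReal.toReal_zero])
    have hm0' : m ≠ 0 := fun h => hm0 (by rw [h, ENNReal.toReal_zero])
    have hfin : p⁻¹ * Au + m⁻¹ * Aw ≠ ⊤ := ENNReal.add_ne_top.2
      ⟨ENNReal.mul_ne_top (ENNReal.inv_ne_top.2 hp0') hAu,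
        ENNReal.mul_ne_top (ENNReal.inv_ne_top.2 hm0') hAw⟩
    have h := ENNReal.toReal_mono hfin (hg hp0' hm0')
    rwa [ENNReal.toReal_add (ENNReal.mul_ne_top (by norm_num) hE) ENNReal.ofReal_ne_top,
      ENNReal.toReal_add (ENNReal.mul_ne_top (ENNReal.inv_ne_top.2 hp0') hAu)
        (ENNReal.mul_ne_top (ENNReal.inv_ne_top.2 hm0') hAw),
      ENNReal.toReal_mul, ENNReal.toReal_mul, ENNReal.toReal_mul, ENNReal.toReal_inv,
      ENNReal.toReal_inv, ENNReal.toReal_ofReal hγ.le, ENNReal.toReal_ofNat] at h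

/-! ### Clustering from the Ky Fan gap -/

/-- **Clustering of near-minimisers from a spectral gap in Ky Fan form** (all measurable `v`, hard
cores included; all `N`, `L`). If `E₀ = periodicGroundStateEnergy v N L` is finite and
`2E₀ + γ ≤ kyFanTwo v N L` for some `γ > 0`, then for every `η > 0`, with `δ = γη/16`, any two
periodic trial states of energy `≤ E₀ + δ` satisfy `∫_{[0,L)^{3N}} |Φ - e^{iθ}Φ'|² ≤ η` for
`θ = arg⟨Φ',Φ⟩_cell` or `θ = arg⟨Φ',Φ⟩_cell + π`. Proof: parallelogram law for the energy form on
the orthogonal pair `Φ ± e^{iθ}Φ'` and Ky Fan's inequality for its normalisation (module docstring).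
[folklore] -/
theorem exists_phase_integral_norm_sub_sq_le_of_kyFanGap (hv : Measurable v) {γ : ℝ} (hγ : 0 < γ)
    (hE : periodicGroundStateEnergy v N L ≠ ⊤)
    (hgap : 2 * periodicGroundStateEnergy v N L + ENNReal.ofReal γ ≤ kyFanTwo v N L)
    {η : ℝ} (hη : 0 < η) :
    ∃ δ : ℝ≥0∞, 0 < δ ∧ ∀ Φ Φ' : PeriodicTrialState N L,
      periodicEnergy v Φ ≤ periodicGroundStateEnergy v N L + δ →
      periodicEnergy v Φ' ≤ periodicGroundStateEnergy v N L + δ →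
      ∃ θ : ℝ, ∫ X in cellN N L, ‖Φ.ψ X - Complex.exp (θ * Complex.I) * Φ'.ψ X‖ ^ 2 ≤ η := by
  refine ⟨ENNReal.ofReal (γ * η / 16), ENNReal.ofReal_pos.2 (by positivity), fun Φ Φ' hΦ hΦ' => ?_⟩
  -- the phase aligning `Φ'` with `Φ`
  set s : ℂ := ∫ X in cellN N L, conj (Φ'.ψ X) * Φ.ψ X with hs
  set c : ℂ := Complex.exp (↑(Complex.arg s) * Complex.I) with hc
  have hc1 : ‖c‖ = 1 := Complex.norm_exp_ofReal_mul_I _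
  have hcc : conj c * c = 1 := by
    rw [Complex.conj_mul', hc1, Complex.ofReal_one, one_pow]
  have hs_polar : s = ↑‖s‖ * c := by rw [hc]; exact (Complex.norm_mul_exp_arg_mul_I s).symm
  have hcs : conj c * s = (‖s‖ : ℂ) := by
    calc conj c * s = conj c * (↑‖s‖ * c) := by rw [← hs_polar]
      _ = ↑‖s‖ * (conj c * c) := by ring
      _ = ↑‖s‖ := by rw [hcc, mul_one]
  -- regularity of `Φ`, `cΦ'`, `u = Φ + cΦ'`, `w = Φ - cΦ'`
  have hΦc : Continuous Φ.ψ := Φ.contDiff.continuous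
  have hΦ'c : Continuous Φ'.ψ := Φ'.contDiff.continuous
  have hcΦ' : ContDiff ℝ 1 (fun X => c * Φ'.ψ X) := contDiff_const.mul Φ'.contDiff
  have hCu : ContDiff ℝ 1 (fun X => Φ.ψ X + c * Φ'.ψ X) := Φ.contDiff.add hcΦ'
  have hCw : ContDiff ℝ 1 (fun X => Φ.ψ X - c * Φ'.ψ X) := Φ.contDiff.sub hcΦ'
  have hper_u : ∀ (X : Config N) (i : Fin N) (k : Fin 3),
      Φ.ψ (X + Pi.single i (EuclideanSpace.single k L)) +
          c * Φ'.ψ (X + Pi.single i (EuclideanSpace.single k L)) = Φ.ψ X + c * Φ'.ψ X :=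
    fun X i k => by rw [Φ.periodic, Φ'.periodic]
  have hper_w : ∀ (X : Config N) (i : Fin N) (k : Fin 3),
      Φ.ψ (X + Pi.single i (EuclideanSpace.single k L)) -
          c * Φ'.ψ (X + Pi.single i (EuclideanSpace.single k L)) = Φ.ψ X - c * Φ'.ψ X :=
    fun X i k => by rw [Φ.periodic, Φ'.periodic]
  have hsymm_u : ∀ (σ : Equiv.Perm (Fin N)) (X : Config N),
      Φ.ψ (X ∘ σ) + c * Φ'.ψ (X ∘ σ) = Φ.ψ X + c * Φ'.ψ X :=
    fun σ X => by rw [Φ.symm, Φ'.symm]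
  have hsymm_w : ∀ (σ : Equiv.Perm (Fin N)) (X : Config N),
      Φ.ψ (X ∘ σ) - c * Φ'.ψ (X ∘ σ) = Φ.ψ X - c * Φ'.ψ X :=
    fun σ X => by rw [Φ.symm, Φ'.symm]
  -- `‖cΦ'‖² = 1`, `q(cΦ') = q(Φ')`
  have hnΦ'' : ∫⁻ X in cellN N L, ((‖c * Φ'.ψ X‖₊ : ℝ≥0∞)) ^ 2 = 1 := by
    rw [lintegral_cellN_sq_const_mul, Φ'.norm_eq, mul_one, ennreal_coe_nnnorm_sq, hc1, one_pow,
      ENNReal.ofReal_one]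
  have hEΦ'' : ∫⁻ X in cellN N L, kineticDensity (fun Y => c * Φ'.ψ Y) X +
      periodicInteraction v L X * ((‖c * Φ'.ψ X‖₊ : ℝ≥0∞)) ^ 2 = periodicEnergy v Φ' := by
    rw [lintegral_periodicEnergy_const_mul v L c Φ'.contDiff, ennreal_coe_nnnorm_sq, hc1, one_pow,
      ENNReal.ofReal_one, one_mul]
    rfl
  -- (F1) `‖u‖² + ‖w‖² = 4`
  have hpm : (∫⁻ X in cellN N L, ((‖Φ.ψ X + c * Φ'.ψ X‖₊ : ℝ≥0∞)) ^ 2) +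
      (∫⁻ X in cellN N L, ((‖Φ.ψ X - c * Φ'.ψ X‖₊ : ℝ≥0∞)) ^ 2) = 4 := by
    rw [lintegral_cellN_sq_add_add_sub L hΦc hcΦ'.continuous, Φ.norm_eq, hnΦ'']
    norm_num
  -- (F2) `q(u) + q(w) ≤ 4E₀ + 4δ`
  have hab : (∫⁻ X in cellN N L, kineticDensity (fun Y => Φ.ψ Y + c * Φ'.ψ Y) X +
        periodicInteraction v L X * ((‖Φ.ψ X + c * Φ'.ψ X‖₊ : ℝ≥0∞)) ^ 2) +
      (∫⁻ X in cellN N L, kineticDensity (fun Y => Φ.ψ Y - c * Φ'.ψ Y) X +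
        periodicInteraction v L X * ((‖Φ.ψ X - c * Φ'.ψ X‖₊ : ℝ≥0∞)) ^ 2) ≤
      4 * periodicGroundStateEnergy v N L + 4 * ENNReal.ofReal (γ * η / 16) := by
    rw [lintegral_periodicEnergy_add_add_sub hv L Φ.contDiff hcΦ', hEΦ'']
    calc 2 * periodicEnergy v Φ + 2 * periodicEnergy v Φ'
        ≤ 2 * (periodicGroundStateEnergy v N L + ENNReal.ofReal (γ * η / 16)) +
          2 * (periodicGroundStateEnergy v N L + ENNReal.ofReal (γ * η / 16)) := by gcongr
      _ = _ := by ring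
  -- (F3) `u ⊥ w` in `L²(cell)`
  have hUW : ∫ X in cellN N L, conj (Φ.ψ X + c * Φ'.ψ X) * (Φ.ψ X - c * Φ'.ψ X) = 0 := by
    have hprod : (fun X => conj (Φ.ψ X + c * Φ'.ψ X) * (Φ.ψ X - c * Φ'.ψ X)) =
        fun X => (conj (Φ.ψ X) * Φ.ψ X - conj c * c * (conj (Φ'.ψ X) * Φ'.ψ X)) +
          (conj c * (conj (Φ'.ψ X) * Φ.ψ X) - conj (conj c * (conj (Φ'.ψ X) * Φ.ψ X))) := by
      funext X; simp only [map_mul, map_add, Complex.conj_conj]; ring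
    have hi1 : IntegrableOn (fun X => conj (Φ.ψ X) * Φ.ψ X) (cellN N L) :=
      integrableOn_cellN (hΦc.star.mul hΦc) L
    have hi4 : IntegrableOn (fun X => conj c * c * (conj (Φ'.ψ X) * Φ'.ψ X)) (cellN N L) :=
      integrableOn_cellN (continuous_const.mul (hΦ'c.star.mul hΦ'c)) L
    have hi3 : IntegrableOn (fun X => conj c * (conj (Φ'.ψ X) * Φ.ψ X)) (cellN N L) :=
      integrableOn_cellN (continuous_const.mul (hΦ'c.star.mul hΦc)) L
    have hi2 : IntegrableOn (fun X => conj (conj c * (conj (Φ'.ψ X) * Φ.ψ X))) (cellN N L) :=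
      integrableOn_cellN (continuous_const.mul (hΦ'c.star.mul hΦc)).star L
    have hi14 : IntegrableOn (fun X => conj (Φ.ψ X) * Φ.ψ X -
        conj c * c * (conj (Φ'.ψ X) * Φ'.ψ X)) (cellN N L) := hi1.sub hi4
    have hi32 : IntegrableOn (fun X => conj c * (conj (Φ'.ψ X) * Φ.ψ X) -
        conj (conj c * (conj (Φ'.ψ X) * Φ.ψ X))) (cellN N L) := hi3.sub hi2
    rw [hprod, integral_add hi14 hi32, integral_sub hi1 hi4, integral_sub hi3 hi2,
      integral_const_mul, integral_const_mul, integral_conj, integral_const_mul,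
      integral_cellN_conj_mul_self_trialState, integral_cellN_conj_mul_self_trialState, ← hs, hcs,
      hcc, Complex.conj_ofReal]
    ring
  -- energies of the normalised states
  have hEnorm : ∀ (U : Config N → ℂ), ContDiff ℝ 1 U → ∀ (Ψ : PeriodicTrialState N L) (a : ℝ),
      (Ψ.ψ = fun X => (a : ℂ) * U X) →
      periodicEnergy v Ψ = ((‖(a : ℂ)‖₊ : ℝ≥0∞)) ^ 2 * ∫⁻ X in cellN N L, kineticDensity U X +
        periodicInteraction v L X * ((‖U X‖₊ : ℝ≥0∞)) ^ 2 := by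
    intro U hU Ψ a h
    unfold periodicEnergy
    rw [h]
    exact lintegral_periodicEnergy_const_mul v L (a : ℂ) hU
  -- (F4) `E₀ ‖u‖² ≤ q(u)` and `E₀ ‖w‖² ≤ q(w)`
  have hFa : (∫⁻ X in cellN N L, ((‖Φ.ψ X + c * Φ'.ψ X‖₊ : ℝ≥0∞)) ^ 2) ≠ 0 →
      periodicGroundStateEnergy v N L *
          (∫⁻ X in cellN N L, ((‖Φ.ψ X + c * Φ'.ψ X‖₊ : ℝ≥0∞)) ^ 2) ≤
        ∫⁻ X in cellN N L, kineticDensity (fun Y => Φ.ψ Y + c * Φ'.ψ Y) X +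
          periodicInteraction v L X * ((‖Φ.ψ X + c * Φ'.ψ X‖₊ : ℝ≥0∞)) ^ 2 := by
    intro hp0
    have hp_top : (∫⁻ X in cellN N L, ((‖Φ.ψ X + c * Φ'.ψ X‖₊ : ℝ≥0∞)) ^ 2) ≠ ⊤ :=
      ne_top_of_le_ne_top (by norm_num) (hpm ▸ le_self_add)
    obtain ⟨û, a, hûψ, ha⟩ := exists_periodicTrialState_const_mul hCu hper_u hsymm_u hp0 hp_top
    have hEu := hEnorm _ hCu û a hûψ
    rw [ha] at hEu
    calc _ ≤ periodicEnergy v û * _ := mul_le_mul' (periodicGroundStateEnergy_le v û) le_rfl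
      _ = _ := by rw [hEu, mul_comm _⁻¹, mul_assoc, ENNReal.inv_mul_cancel hp0 hp_top, mul_one]
  have hFb : (∫⁻ X in cellN N L, ((‖Φ.ψ X - c * Φ'.ψ X‖₊ : ℝ≥0∞)) ^ 2) ≠ 0 →
      periodicGroundStateEnergy v N L *
          (∫⁻ X in cellN N L, ((‖Φ.ψ X - c * Φ'.ψ X‖₊ : ℝ≥0∞)) ^ 2) ≤
        ∫⁻ X in cellN N L, kineticDensity (fun Y => Φ.ψ Y - c * Φ'.ψ Y) X +
          periodicInteraction v L X * ((‖Φ.ψ X - c * Φ'.ψ X‖₊ : ℝ≥0∞)) ^ 2 := by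
    intro hm0
    have hm_top : (∫⁻ X in cellN N L, ((‖Φ.ψ X - c * Φ'.ψ X‖₊ : ℝ≥0∞)) ^ 2) ≠ ⊤ :=
      ne_top_of_le_ne_top (by norm_num) (hpm ▸ le_add_self)
    obtain ⟨ŵ, b, hŵψ, hb⟩ := exists_periodicTrialState_const_mul hCw hper_w hsymm_w hm0 hm_top
    have hEw := hEnorm _ hCw ŵ b hŵψ
    rw [hb] at hEw
    calc _ ≤ periodicEnergy v ŵ * _ := mul_le_mul' (periodicGroundStateEnergy_le v ŵ) le_rfl
      _ = _ := by rw [hEw, mul_comm _⁻¹, mul_assoc, ENNReal.inv_mul_cancel hm0 hm_top, mul_one]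
  -- (F5) the Ky Fan gap tested on the orthogonal pair `û, ŵ`
  have hF5 : (∫⁻ X in cellN N L, ((‖Φ.ψ X + c * Φ'.ψ X‖₊ : ℝ≥0∞)) ^ 2) ≠ 0 →
      (∫⁻ X in cellN N L, ((‖Φ.ψ X - c * Φ'.ψ X‖₊ : ℝ≥0∞)) ^ 2) ≠ 0 →
      2 * periodicGroundStateEnergy v N L + ENNReal.ofReal γ ≤
        (∫⁻ X in cellN N L, ((‖Φ.ψ X + c * Φ'.ψ X‖₊ : ℝ≥0∞)) ^ 2)⁻¹ *
          (∫⁻ X in cellN N L, kineticDensity (fun Y => Φ.ψ Y + c * Φ'.ψ Y) X +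
            periodicInteraction v L X * ((‖Φ.ψ X + c * Φ'.ψ X‖₊ : ℝ≥0∞)) ^ 2) +
        (∫⁻ X in cellN N L, ((‖Φ.ψ X - c * Φ'.ψ X‖₊ : ℝ≥0∞)) ^ 2)⁻¹ *
          (∫⁻ X in cellN N L, kineticDensity (fun Y => Φ.ψ Y - c * Φ'.ψ Y) X +
            periodicInteraction v L X * ((‖Φ.ψ X - c * Φ'.ψ X‖₊ : ℝ≥0∞)) ^ 2) := by
    intro hp0 hm0
    have hp_top : (∫⁻ X in cellN N L, ((‖Φ.ψ X + c * Φ'.ψ X‖₊ : ℝ≥0∞)) ^ 2) ≠ ⊤ :=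
      ne_top_of_le_ne_top (by norm_num) (hpm ▸ le_self_add)
    have hm_top : (∫⁻ X in cellN N L, ((‖Φ.ψ X - c * Φ'.ψ X‖₊ : ℝ≥0∞)) ^ 2) ≠ ⊤ :=
      ne_top_of_le_ne_top (by norm_num) (hpm ▸ le_add_self)
    obtain ⟨û, a, hûψ, ha⟩ := exists_periodicTrialState_const_mul hCu hper_u hsymm_u hp0 hp_top
    obtain ⟨ŵ, b, hŵψ, hb⟩ := exists_periodicTrialState_const_mul hCw hper_w hsymm_w hm0 hm_top
    have hEu := hEnorm _ hCu û a hûψ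
    rw [ha] at hEu
    have hEw := hEnorm _ hCw ŵ b hŵψ
    rw [hb] at hEw
    have horth : ∫ X in cellN N L, conj (û.ψ X) * ŵ.ψ X = 0 := by
      rw [hûψ, hŵψ]
      have h2 : (fun X => conj ((a : ℂ) * (Φ.ψ X + c * Φ'.ψ X)) * ((b : ℂ) * (Φ.ψ X - c * Φ'.ψ X))) =
          fun X => (conj (a : ℂ) * b) * (conj (Φ.ψ X + c * Φ'.ψ X) * (Φ.ψ X - c * Φ'.ψ X)) := by
        funext X; simp only [map_mul]; ring
      rw [h2, integral_const_mul, hUW, mul_zero]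
    calc 2 * periodicGroundStateEnergy v N L + ENNReal.ofReal γ ≤ kyFanTwo v N L := hgap
      _ ≤ periodicEnergy v û + periodicEnergy v ŵ :=
        (iInf_le _ û).trans ((iInf_le _ ŵ).trans (iInf_le _ horth))
      _ = _ := by rw [hEu, hEw]
  -- bookkeeping: `min(‖u‖², ‖w‖²) ≤ 8δ/γ = η/2`
  have key := min_toReal_le_of_kyFan_bookkeeping hγ (by positivity : (0 : ℝ) ≤ γ * η / 16) hE hpm
    hab hFa hFb hF5
  have key' : min (∫⁻ X in cellN N L, ((‖Φ.ψ X + c * Φ'.ψ X‖₊ : ℝ≥0∞)) ^ 2).toReal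
      (∫⁻ X in cellN N L, ((‖Φ.ψ X - c * Φ'.ψ X‖₊ : ℝ≥0∞)) ^ 2).toReal ≤ η := by
    calc _ ≤ 8 * (γ * η / 16) / γ := key
      _ = η / 2 := by field_simp; ring
      _ ≤ η := by linarith
  rcases le_total (∫⁻ X in cellN N L, ((‖Φ.ψ X - c * Φ'.ψ X‖₊ : ℝ≥0∞)) ^ 2).toReal
    (∫⁻ X in cellN N L, ((‖Φ.ψ X + c * Φ'.ψ X‖₊ : ℝ≥0∞)) ^ 2).toReal with h | h
  · -- `w = Φ - cΦ'` is the small one: `θ = arg s`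
    refine ⟨Complex.arg s, ?_⟩
    rw [← hc, integral_cellN_norm_sq_eq_toReal L (F := fun X => Φ.ψ X - c * Φ'.ψ X)
      (hΦc.sub hcΦ'.continuous)]
    exact (min_eq_right h ▸ key')
  · -- `u = Φ + cΦ'` is the small one: `θ = arg s + π`
    refine ⟨Complex.arg s + Real.pi, ?_⟩
    have hneg : Complex.exp (↑(Complex.arg s + Real.pi) * Complex.I) = -c := by
      rw [Complex.ofReal_add, add_mul, Complex.exp_add, Complex.exp_pi_mul_I, hc, mul_neg_one]
    simp_rw [hneg, neg_mul, sub_neg_eq_add]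
    rw [integral_cellN_norm_sq_eq_toReal L (F := fun X => Φ.ψ X + c * Φ'.ψ X)
      (hΦc.add hcΦ'.continuous)]
    exact (min_eq_left h ▸ key')

end Literature.MathematicalPhysics.QuantumManyBody.BoseGas

end
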